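import Literature.MathematicalPhysics.KineticTheory.PureQuarticChainMinorization
import Literature.MathematicalPhysics.KineticTheory.PureQuarticChainHormander
import Literature.MathematicalPhysics.KineticTheory.LangevinSemigroupHarrisOne
import HarnessLib

/-!
# CEHR Theorem 2.13 for the purely quartic chain from H2 at time one (the assembly)

Topic `Literature/MathematicalPhysics/KineticTheory` (trunk T-KINETIC). Assembly file of the
provefact unit for the named fact `CuneoEckmannHairerReyBellet2018_thm213_pureQuartic`
(`PureQuarticChainNESS.lean`): Cuneo–Eckmann–Hairer–Rey-Bellet, EJP **23** (2018) no. 55,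
Theorem 2.13 (1)–(3) for `pureQuarticChain μ γ = ⟨μq⁴/4, r⁴/4, γ⟩` (`μ, γ > 0`, `N ≥ 1`,
`T_L, T_R > 0`), following the paper's proof of Thm 3.1 on the model-free confined pipeline
(`LangevinChainConfined.lean`, witness semigroup `(pureQuarticChain_isConfining …).semigroup`):

* the semigroup, its Feller property and the a-priori bound (3.4)
  (`PureQuarticChainConfined.lean`);
* smooth densities of invariant measures, Props. 3.2 / 4.1 with the higher brackets `V⁗ = 6`
  (`PureQuarticChainHormander.lean`);
* the minorisation Prop. 3.6, proved through the forced equilibrium of Lemma 4.4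
  (`PureQuarticChainMinorization.lean`);
* Krylov–Bogoliubov (Prop. 3.7), Harris (Prop. 3.8), uniqueness and (2.5) from H2 **at the single
  time `t* = 1`** and the minorisation (`LangevinSemigroupHarrisOne.lean`; the skeleton
  `P_m = P_1^m` only uses H2 at time one).

The remaining analytic input is the Lyapunov condition H2 (CEHR Thm 5.1 / Rem 5.2) in the form
`∫ e^{θH} dP_1(z,·) ≤ κ e^{θH(z)} + c`, `0 ≤ κ < 1`, `c ≥ 0`, for every `0 < θ < 1/max(T_L,T_R)`;
it is the hypothesis of `CuneoEckmannHairerReyBellet2018_thm213_pureQuartic_of_H2_one` and is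
proved in `PureQuarticChainNESSProofs.lean` (`pureQuarticChain_H2`), which imports this file and
concludes. The compact set of CEHR's H2 ("`P V ≤ κV + c 1_K`") is recovered from the compact
sublevel sets of `H` (`exists_compactIndicator_bound_of_const_bound`). Two theorems, proved; no
definition, no named fact.

## References

* N. Cuneo, J.-P. Eckmann, M. Hairer, L. Rey-Bellet, EJP **23** (2018) no. 55 (arXiv:1712.09413):
  Thm 2.13, Thm 3.1, §3 (H1)/(H2), Props. 3.2, 3.6, 3.7, 3.8, Prop. 4.1, Rem 5.2.
-/

noncomputable section

open MeasureTheory ProbabilityTheory Filter Topology Set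
open scoped NNReal ENNReal

namespace Literature.MathematicalPhysics.KineticTheory.HeatConduction

open Literature.Probability.Process OscillatorChain

/-- **From H2 with an additive constant to H2 with a compact indicator**: if `H` has compact
sublevel sets and `F(z) ≤ κ e^{θH(z)} + c` with `0 ≤ κ < 1`, `c ≥ 0`, then
`F(z) ≤ κ' e^{θH(z)} + c' 1_K(z)` with `κ' = (κ+1)/2`, `c' = c + 1` and the compact
`K = {H ≤ E}`, `E = θ⁻¹ log((2c+2)/(1-κ))` (off `K`, `c ≤ (1-κ)/2 · e^{θH}`). This converts the
conclusion shape of `OscillatorChain.IsConfining.H2_of_decay` (`LangevinChainConfinedH2Shell.lean`)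
into the hypothesis shape of `LangevinSemigroupHarris.lean` (CEHR H2: "`c > 0` is a constant and
`K` is a compact set"). [cite: CuneoEckmannHairerReyBellet2018, §3 H2 and Rem 5.2] -/
theorem exists_compactIndicator_bound_of_const_bound {N : ℕ} (H : PhaseSpace N → ℝ)
    (hcpt : ∀ E : ℝ, IsCompact {z : PhaseSpace N | H z ≤ E}) {θ : ℝ} (hθ : 0 < θ)
    {κ c : ℝ} (hκ0 : 0 ≤ κ) (hκ1 : κ < 1) (hc : 0 ≤ c) {F : PhaseSpace N → ℝ≥0∞}
    (h : ∀ z, F z ≤ ENNReal.ofReal (κ * Real.exp (θ * H z) + c)) :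
    ∃ (κ' c' : ℝ) (K : Set (PhaseSpace N)), 0 < κ' ∧ κ' < 1 ∧ 0 < c' ∧ IsCompact K ∧
      ∀ z, F z ≤ ENNReal.ofReal (κ' * Real.exp (θ * H z) + c' * K.indicator 1 z) := by
  set E : ℝ := Real.log ((2 * c + 2) / (1 - κ)) / θ with hE
  refine ⟨(κ + 1) / 2, c + 1, {z | H z ≤ E}, by linarith, by linarith, by linarith, hcpt E, fun z => ?_⟩
  refine (h z).trans (ENNReal.ofReal_le_ofReal ?_)
  have he : 0 < Real.exp (θ * H z) := Real.exp_pos _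
  by_cases hz : H z ≤ E
  · rw [indicator_of_mem (show z ∈ {z : PhaseSpace N | H z ≤ E} from hz), Pi.one_apply, mul_one]
    nlinarith
  · rw [indicator_of_notMem (show z ∉ {z : PhaseSpace N | H z ≤ E} from hz), mul_zero, add_zero]
    have hz' : E < H z := not_le.1 hz
    have h1κ : 0 < 1 - κ := by linarith
    have hpos : 0 < (2 * c + 2) / (1 - κ) := by positivity
    have hlog : Real.log ((2 * c + 2) / (1 - κ)) < θ * H z := by
      rw [hE, div_lt_iff₀ hθ] at hz'
      linarith
    have hexp : (2 * c + 2) / (1 - κ) < Real.exp (θ * H z) := by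
      rw [← Real.exp_log hpos]
      exact Real.exp_lt_exp.2 hlog
    rw [div_lt_iff₀ h1κ] at hexp
    nlinarith


/-- **Cuneo–Eckmann–Hairer–Rey-Bellet 2018, Theorem 2.13 for the purely quartic chain, from the
Lyapunov condition H2 at time `t* = 1` alone** — the form in which the sibling unit of
`CuneoEckmannHairerReyBellet2018_pureQuarticChain` states H2 (`PureQuarticChainSemigroup.lean`:
for every `0 < θ < 1/max(T_L,T_R)` there are `κ ∈ [0,1)`, `c ≥ 0` with
`∫ e^{θH} dP_1(z, ·) ≤ κ e^{θH(z)} + c`, Remark 5.2 at `t* = 1`). Same assembly as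
`CuneoEckmannHairerReyBellet2018_thm213_pureQuartic_of_H2`, through the `t* = 1` variants of
`LangevinSemigroupHarrisOne.lean` (Krylov–Bogoliubov and Harris on the skeleton `P_m = P_1^m` only
use H2 at time one). [cite: CuneoEckmannHairerReyBellet2018, Thm 2.13 and Thm 3.1] -/
theorem CuneoEckmannHairerReyBellet2018_thm213_pureQuartic_of_H2_one
    (h2 : ∀ μ γ : ℝ, 0 < μ → 0 < γ → ∀ (N : ℕ) (T_L T_R : ℝ), 0 < N → 0 < T_L → 0 < T_R →
      ∀ θ : ℝ, 0 < θ → θ < 1 / max T_L T_R →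
        ∃ κ c : ℝ, 0 ≤ κ ∧ κ < 1 ∧ 0 ≤ c ∧
          ∀ z : PhaseSpace N,
            ∫⁻ y, ENNReal.ofReal (Real.exp (θ * (pureQuarticChain μ γ).hamiltonian N y))
                ∂((pureQuarticChain μ γ).langevinKernel N T_L T_R 1 z) ≤
              ENNReal.ofReal (κ * Real.exp (θ * (pureQuarticChain μ γ).hamiltonian N z) + c)) :
    CuneoEckmannHairerReyBellet2018_thm213_pureQuartic := by
  intro μ γ hμ hγ N T_L T_R hN hL hR
  set S : LangevinChainSemigroup (pureQuarticChain μ γ) N T_L T_R :=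
    (pureQuarticChain_isConfining hμ hγ.le).semigroup N T_L T_R hN hL.le hR.le with hS
  have hTm : 0 < 1 / max T_L T_R := by positivity
  have hF : ∀ (t : ℝ≥0) (g : BoundedContinuousFunction (PhaseSpace N) ℝ), Continuous (S.act t g) :=
    pureQuarticChain_continuous_act_semigroup hμ hγ.le hN hL.le hR.le
  have hHc : Continuous ((pureQuarticChain μ γ).hamiltonian N) := pureQuarticChain_continuous_hamiltonian μ γ N
  have hcpt : ∀ θ : ℝ, 0 < θ → ∀ R : ℝ≥0, IsCompact {x : PhaseSpace N |
      (Real.exp (θ * (pureQuarticChain μ γ).hamiltonian N x)).toNNReal ≤ R} := fun θ hθ R =>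
    pureQuarticChain_isCompact_setOf_exp_le hμ γ N hθ R
  have hCstar : ∀ θ : ℝ, 0 < θ → 0 ≤ θ * γ * (T_L + T_R) := fun θ hθ => by positivity
  have h34 : ∀ θ : ℝ, 0 < θ → θ < 1 / max T_L T_R → ∀ (t : ℝ≥0) (z : PhaseSpace N),
      ∫⁻ y, ENNReal.ofReal (Real.exp (θ * (pureQuarticChain μ γ).hamiltonian N y)) ∂(S.kernel t z) ≤
        ENNReal.ofReal (Real.exp (θ * γ * (T_L + T_R) * t) *
          Real.exp (θ * (pureQuarticChain μ γ).hamiltonian N z)) := fun θ hθ hθ' t z =>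
    pureQuarticChain_lintegral_exp_mul_hamiltonian_kernel_le hμ hγ.le hN hL.le hR.le hL hθ hθ' t z
  have h2S : ∀ θ : ℝ, 0 < θ → θ < 1 / max T_L T_R →
      ∃ (κ c : ℝ) (K : Set (PhaseSpace N)), 0 < κ ∧ κ < 1 ∧ 0 < c ∧ IsCompact K ∧
        ∀ z : PhaseSpace N,
          ∫⁻ y, ENNReal.ofReal (Real.exp (θ * (pureQuarticChain μ γ).hamiltonian N y)) ∂(S.kernel 1 z) ≤
            ENNReal.ofReal (κ * Real.exp (θ * (pureQuarticChain μ γ).hamiltonian N z) +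
              c * K.indicator 1 z) := by
    intro θ hθ hθ'
    obtain ⟨κ, c, hκ0, hκ1, hc, hb⟩ := h2 μ γ hμ hγ N T_L T_R hN hL hR θ hθ hθ'
    exact exists_compactIndicator_bound_of_const_bound ((pureQuarticChain μ γ).hamiltonian N)
      (pureQuarticChain_isCompact_setOf_hamiltonian_le hμ γ N) hθ hκ0 hκ1 hc hb
  have h36 : ∀ C : Set (PhaseSpace N), IsCompact C → ∃ t_C : ℝ≥0, ∀ t : ℝ≥0, t_C ≤ t →
      ∃ ν : Measure (PhaseSpace N), ν ≠ 0 ∧ ∀ z ∈ C, ν ≤ S.kernel t z :=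
    pureQuarticChain_minorization hμ hγ hN hL T_R
  have hH0 : ∀ z, 0 ≤ (pureQuarticChain μ γ).hamiltonian N z :=
    pureQuarticChain_hamiltonian_nonneg hμ.le γ N
  obtain ⟨ms, hms, hinv, hint⟩ :=
    S.exists_isInvariant_of_H2_one hF hHc hcpt (Cstar := fun θ => θ * γ * (T_L + T_R)) hCstar h34 h2S hTm
  refine ⟨S, ?_, ?_, ms, hms, hinv, fun ϑ hϑ0 hϑ1 => ⟨hint ϑ hϑ0 hϑ1, ?_⟩⟩
  · intro m m' hm hm' hmi hm'i
    haveI := hm; haveI := hm'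
    exact S.invariant_unique_of_H2_one_of_minorization hHc hcpt h2S hTm h36 m m' hmi hm'i
  · intro m hm hmi
    haveI := hm
    exact pureQuarticChain_hasSmoothDensity_of_isInvariant μ hγ hN hL hR.le S m hmi
  · exact S.exp_convergence_of_H2_one_of_minorization hHc hcpt (Cstar := fun θ => θ * γ * (T_L + T_R))
      hCstar h34 h2S hH0 h36 hϑ0 hϑ1 ms hinv

end Literature.MathematicalPhysics.KineticTheory.HeatConduction

end
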